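import Mathlib
import Summits.SmoothPoincare4.SmoothPoincare4.Theses.CylinderEntropy
import Literature.Geometry.Riemannian.SphericalCylinderEntropy

/-!
# Triage r2-3 (crux 7633) kernel checks: (1) costume certificate for `rigid-rung-circle-cancellation`; (2) the `dynamic-certificate` skeleton over an abstract `Good` is a tautological cut

The three stubs `Cancel`, `RNatLe`, `ENatLe` are copied VERBATIM from `Cruxes/ThinCrossSectionExists/SketchIdeator6.lean`
(with the Disproof abbreviations `InN`, `Separates`, `level` unfolded to their definitions there).  They prove the SUMMIT in
three lines, so the card's composition `crux_of_rigidRung = crossSectionBelow_of_diffeomorph hcal φ` is `crux_of_spc4 ∘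
spc4_of_stubs`: witness = slice ∘ φ, the round-1 no-skeleton shape.
-/

noncomputable section

open scoped Manifold ContDiff ENNReal ContinuousMap
open Literature.Geometry.Riemannian.SphericalCylinderEntropy (cylEntropy)

namespace TriageR23

local notation "E⁶" => EuclideanSpace ℝ (Fin 6)
local notation "E⁴" => EuclideanSpace ℝ (Fin 4)
local notation "𝕊⁴" => (Metric.sphere (0 : EuclideanSpace ℝ (Fin 5)) 1)

def InN (z : E⁶) : Prop := ∑ i : Fin 5, z (Fin.castSucc i) ^ 2 = 1
def cylN : Set E⁶ := {z | InN z}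
def Separates (A : Set E⁶) : Prop :=
  ∃ R : ℝ, ∀ a b : E⁶, InN a → InN b → a 5 ≤ -R → R ≤ b 5 → ¬ JoinedIn (cylN \ A) a b
def level : ℝ≥0∞ := ENNReal.ofReal (4 / Real.exp 1)

variable (IsCircleSumSphere :
  ∀ (X : Type) [TopologicalSpace X] [ChartedSpace E⁴ X] (k : ℕ) (M : Type) [TopologicalSpace M]
    [ChartedSpace E⁴ M], Prop)

def Cancel : Prop :=
  ∀ (X : Type) [TopologicalSpace X] [T2Space X] [SecondCountableTopology X] [ChartedSpace E⁴ X]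
    [IsManifold (𝓡 4) ∞ X], X ≃ₕ 𝕊⁴ →
    ∀ (k k' : ℕ) (M : Type) [TopologicalSpace M] [T2Space M] [SecondCountableTopology M]
      [ChartedSpace E⁴ M] [IsManifold (𝓡 4) ∞ M],
      IsCircleSumSphere X k M → IsCircleSumSphere 𝕊⁴ k' M → Nonempty (X ≃ₘ⟮𝓡 4, 𝓡 4⟯ 𝕊⁴)

def RNatLe : Prop :=
  ∀ (M : Type) [TopologicalSpace M] [T2Space M] [SecondCountableTopology M] [CompactSpace M]
    [ChartedSpace E⁴ M] [IsManifold (𝓡 4) ∞ M] (ι : M → E⁶),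
    Manifold.IsSmoothEmbedding (𝓡 4) (𝓡 6) ∞ ι → (∀ x, InN (ι x)) → Separates (Set.range ι) →
    cylEntropy (Set.range ι) ≤ level → ∃ k : ℕ, IsCircleSumSphere 𝕊⁴ k M

def ENatLe : Prop :=
  ∀ (X : Type) [TopologicalSpace X] [T2Space X] [SecondCountableTopology X] [ChartedSpace E⁴ X]
    [IsManifold (𝓡 4) ∞ X], X ≃ₕ 𝕊⁴ →
    ∃ (k : ℕ) (M : Type) (_ : TopologicalSpace M) (_ : T2Space M) (_ : SecondCountableTopology M)
      (_ : CompactSpace M) (_ : ChartedSpace E⁴ M) (_ : IsManifold (𝓡 4) ∞ M),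
      IsCircleSumSphere X k M ∧ ∃ ι : M → E⁶, Manifold.IsSmoothEmbedding (𝓡 4) (𝓡 6) ∞ ι ∧
        (∀ x, InN (ι x)) ∧ Separates (Set.range ι) ∧ cylEntropy (Set.range ι) ≤ level

/-- **The three stubs prove the summit outright** (no calibration, no cross-section of `X` is ever built). -/
theorem spc4_of_stubs (hC : Cancel IsCircleSumSphere) (hR : RNatLe IsCircleSumSphere)
    (hE : ENatLe IsCircleSumSphere) : _root_.SmoothPoincare4 := by
  unfold _root_.SmoothPoincare4 Literature.SPC4.SmoothPoincareConjectureFour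
    ContinuousMap.HomotopyEquiv.NonemptyDiffeomorphSphere
  intro X _ _ _ _ _ e
  obtain ⟨k, M, _, _, _, _, _, _, hsum, ι, hι, hN, hsep, hle⟩ := hE X e
  obtain ⟨k', hsum'⟩ := hR M ι hι hN hsep hle
  exact hC X e k k' M hsum hsum'

/-- Junk model of the posited predicate: with `IsCircleSumSphere := True` the stub `Cancel` alone is the summit. -/
theorem spc4_of_cancel_true (hC : Cancel (fun _ _ _ _ _ _ _ => True)) : _root_.SmoothPoincare4 := by
  unfold _root_.SmoothPoincare4 Literature.SPC4.SmoothPoincareConjectureFour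
    ContinuousMap.HomotopyEquiv.NonemptyDiffeomorphSphere
  intro X _ _ _ _ _ e
  exact hC X e 0 0 𝕊⁴ trivial trivial

/-- … and with `IsCircleSumSphere := True`, `RNatLe` is trivially true (so it constrains nothing either). -/
theorem rNatLe_true : RNatLe (fun _ _ _ _ _ _ _ => True) := by
  intro M _ _ _ _ _ _ ι _ _ _ _
  exact ⟨0, trivial⟩

end TriageR23

open Summit.SmoothPoincare4.SmoothPoincare4.Theses.CylinderEntropy (ThinCrossSectionExists)

namespace TriageR23Dyn

local notation "E⁶" => EuclideanSpace ℝ (Fin 6)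
local notation "E⁴" => EuclideanSpace ℝ (Fin 4)
local notation "𝕊⁴" => (Metric.sphere (0 : EuclideanSpace ℝ (Fin 5)) 1)

def InN (z : E⁶) : Prop := ∑ i : Fin 5, z (Fin.castSucc i) ^ 2 = 1
def Separates (A : Set E⁶) : Prop :=
  ∃ R : ℝ, ∀ a b : E⁶, InN a → InN b → a 5 ≤ -R → R ≤ b 5 → ¬ JoinedIn ({z : E⁶ | InN z} \ A) a b
def level : ℝ≥0∞ := ENNReal.ofReal (4 / Real.exp 1)
def CrossSectionBelow (c : ℝ≥0∞) (M : Type) [TopologicalSpace M] [ChartedSpace E⁴ M] : Prop :=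
  ∃ ι : M → E⁶, Manifold.IsSmoothEmbedding (𝓡 4) (𝓡 6) ∞ ι ∧ (∀ x, InN (ι x)) ∧
    Separates (Set.range ι) ∧ cylEntropy (Set.range ι) < c

section Skeleton
variable (Good : ∀ {M : Type} [TopologicalSpace M] [ChartedSpace E⁴ M], (M → E⁶) → Prop)

def ExistsGood : Prop :=
  ∀ (M : Type) [TopologicalSpace M] [T2Space M] [SecondCountableTopology M]
    [ChartedSpace E⁴ M] [IsManifold (𝓡 4) ∞ M], M ≃ₕ 𝕊⁴ →
    ∃ ι : M → E⁶, Manifold.IsSmoothEmbedding (𝓡 4) (𝓡 6) ∞ ι ∧ (∀ x, InN (ι x)) ∧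
      Separates (Set.range ι) ∧ Good ι

def Certificate : Prop :=
  ∀ (M : Type) [TopologicalSpace M] [T2Space M] [SecondCountableTopology M]
    [ChartedSpace E⁴ M] [IsManifold (𝓡 4) ∞ M] (ι : M → E⁶),
    Manifold.IsSmoothEmbedding (𝓡 4) (𝓡 6) ∞ ι → (∀ x, InN (ι x)) → Separates (Set.range ι) →
      Good ι → CrossSectionBelow level M
end Skeleton

/-- The instantiation that exposes the cut: `Good ι := λ_cyl(range ι) < 4/e`. -/
def thinGood {M : Type} [TopologicalSpace M] [ChartedSpace E⁴ M] (ι : M → E⁶) : Prop :=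
  cylEntropy (Set.range ι) < level

/-- With `Good := thin`, the "hard stub" is literally the crux. -/
theorem existsGood_thin_iff : ExistsGood (fun ι => thinGood ι) ↔ ThinCrossSectionExists := Iff.rfl

/-- With `Good := thin`, the "certificate" is trivially true. -/
theorem certificate_thin : Certificate (fun ι => thinGood ι) := by
  intro M _ _ _ _ _ ι hι hN hsep hgood
  exact ⟨ι, hι, hN, hsep, hgood⟩

/-- The card's composition, for any `Good` (pure modus ponens through the middle term). -/
theorem crux_of_certificate
    (Good : ∀ {M : Type} [TopologicalSpace M] [ChartedSpace E⁴ M], (M → E⁶) → Prop)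
    (hE : ExistsGood Good) (hC : Certificate Good) : ThinCrossSectionExists := by
  intro M _ _ _ _ _ e
  obtain ⟨ι, hι, hN, hsep, hgood⟩ := hE M e
  exact hC M ι hι hN hsep hgood

end TriageR23Dyn

end
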